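import Literature.Algebra.Homology.StupidFiltrationExactFunctor
import Literature.Algebra.Homology.HyperExtComap
import HarnessLib

/-!
# Restriction of the stupid-filtration connecting maps along an exact functor

For an exact functor `F : C ⥤ D` of abelian categories, an isomorphism `e : F X ≅ X'`, complexes
`K` on `C`, `K'` on `D` and a morphism `g : F K ⟶ K'`, the "restriction" maps
`HyperExt X (σ≤n₀ K) k → HyperExt X' (σ≤n₀ K') k` and
`HyperExt X (Kⁿ¹[-n₁]) k → HyperExt X' (K'ⁿ¹[-n₁]) k`
(`HyperExt.restrictStupidFiltration₃/₁`) commute with the connecting homomorphisms of the stupid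
filtrations `0 → Kⁿ¹[-n₁] → σ≤n₁ K → σ≤n₀ K → 0` (`restrictStupidFiltration_delta`), and torsion
statements about `δ` transfer from `K'` to `K` when the restriction has torsion kernel
(`exists_smul_delta_eq_zero_of_restrict`).

The case in view: `F` the restriction of abelian sheaves to an open subscheme `U ⊆ 𝒳`
(`Topology/SheafOpenRestriction`), `X, X'` the constant sheaves `ℤ`, `K = Ω•_{𝒳/W}`,
`K' = Ω•_{U/K}`: the Hodge-to-de Rham connecting maps of `𝒳` restrict to those of the generic fibre.

## References

Folklore (naturality of connecting homomorphisms: C. Weibel, *An introduction to homological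
algebra*, 1.3 and 10.2). [folklore]
-/

open CategoryTheory Limits CochainComplex

namespace Literature.Algebra.Homology

universe w w' v v' u u'

variable {C : Type u} [Category.{v} C] [Abelian C] {D : Type u'} [Category.{v'} D] [Abelian D]
  (F : C ⥤ D) [F.Additive] [PreservesFiniteLimits F] [PreservesFiniteColimits F]
  {X : C} {X' : D} (e : F.obj X ≅ X') {K : CochainComplex C ℤ} {K' : CochainComplex D ℤ}
  (g : (F.mapHomologicalComplex (ComplexShape.up ℤ)).obj K ⟶ K') (n₀ n₁ : ℤ) (h : n₀ + 1 = n₁)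

set_option backward.isDefEq.respectTransparency false

namespace HyperExt

/-- **Restriction on the `σ≤n₀` terms**: `HyperExt X (σ≤n₀ K) k → HyperExt X' (σ≤n₀ K') k`, the
composite of `mapExactFunctor F` (`HyperExtExactFunctor`), the identification
`F(σ≤n₀ K) ≅ σ≤n₀ (F K)` (`StupidFiltrationFunctor`), the map induced by `g : F K ⟶ K'`
(`stupidFiltrationShortComplexMap`) and the change of first argument along `e : F X ≅ X'`
(`HyperExtComap`). For `F` = restriction to an open `U`, `X, X'` the constant sheaves `ℤ`, this is
the restriction map `ℍᵏ(X, σ≤n₀ K) → ℍᵏ(U, σ≤n₀ K')` of hypercohomology. [folklore] -/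
noncomputable def restrictStupidFiltration₃ (k : ℤ)
    [HasHyperExt.{w} X (stupidFiltrationShortComplex K n₀ n₁ h).X₃]
    [h₃ : HasHyperExt.{w'} (F.obj X) ((F.mapHomologicalComplex (ComplexShape.up ℤ)).obj
      (stupidFiltrationShortComplex K n₀ n₁ h).X₃)]
    [HasHyperExt.{w'} (F.obj X) (stupidFiltrationShortComplex
      ((F.mapHomologicalComplex (ComplexShape.up ℤ)).obj K) n₀ n₁ h).X₃]
    [HasHyperExt.{w'} (F.obj X) (stupidFiltrationShortComplex K' n₀ n₁ h).X₃]
    [HasHyperExt.{w'} X' (stupidFiltrationShortComplex K' n₀ n₁ h).X₃] :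
    HyperExt.{w} X (stupidFiltrationShortComplex K n₀ n₁ h).X₃ k →+
      HyperExt.{w'} X' (stupidFiltrationShortComplex K' n₀ n₁ h).X₃ k :=
  haveI : HasHyperExt.{w'} (F.obj X) ((stupidFiltrationShortComplex K n₀ n₁ h).map
    (F.mapHomologicalComplex (ComplexShape.up ℤ))).X₃ := h₃
  (comapEquivOfIso _ k e).toAddMonoidHom.comp <|
    (map (stupidFiltrationShortComplexMap g n₀ n₁ h).τ₃ k).comp <|
      (map (mapStupidFiltrationShortComplexIso F K n₀ n₁ h).hom.τ₃ k).comp (mapExactFunctor F k)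

/-- **Restriction on the `Kⁿ¹[-n₁]` terms**, likewise. [folklore] -/
noncomputable def restrictStupidFiltration₁ (k : ℤ)
    [HasHyperExt.{w} X (stupidFiltrationShortComplex K n₀ n₁ h).X₁]
    [h₁ : HasHyperExt.{w'} (F.obj X) ((F.mapHomologicalComplex (ComplexShape.up ℤ)).obj
      (stupidFiltrationShortComplex K n₀ n₁ h).X₁)]
    [HasHyperExt.{w'} (F.obj X) (stupidFiltrationShortComplex
      ((F.mapHomologicalComplex (ComplexShape.up ℤ)).obj K) n₀ n₁ h).X₁]
    [HasHyperExt.{w'} (F.obj X) (stupidFiltrationShortComplex K' n₀ n₁ h).X₁]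
    [HasHyperExt.{w'} X' (stupidFiltrationShortComplex K' n₀ n₁ h).X₁] :
    HyperExt.{w} X (stupidFiltrationShortComplex K n₀ n₁ h).X₁ k →+
      HyperExt.{w'} X' (stupidFiltrationShortComplex K' n₀ n₁ h).X₁ k :=
  haveI : HasHyperExt.{w'} (F.obj X) ((stupidFiltrationShortComplex K n₀ n₁ h).map
    (F.mapHomologicalComplex (ComplexShape.up ℤ))).X₁ := h₁
  (comapEquivOfIso _ k e).toAddMonoidHom.comp <|
    (map (stupidFiltrationShortComplexMap g n₀ n₁ h).τ₁ k).comp <|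
      (map (mapStupidFiltrationShortComplexIso F K n₀ n₁ h).hom.τ₁ k).comp (mapExactFunctor F k)

/-- **The restriction maps commute with the connecting homomorphisms of the stupid filtrations**
(`mapExactFunctor_delta`, `delta_naturality`, `delta_comap` assembled). [folklore] -/
theorem restrictStupidFiltration_delta (k₀ k₁ : ℤ) (hk : k₀ + 1 = k₁)
    [HasHyperExt.{w} X (stupidFiltrationShortComplex K n₀ n₁ h).X₁]
    [HasHyperExt.{w} X (stupidFiltrationShortComplex K n₀ n₁ h).X₃]
    [h₁ : HasHyperExt.{w'} (F.obj X) ((F.mapHomologicalComplex (ComplexShape.up ℤ)).obj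
      (stupidFiltrationShortComplex K n₀ n₁ h).X₁)]
    [h₃ : HasHyperExt.{w'} (F.obj X) ((F.mapHomologicalComplex (ComplexShape.up ℤ)).obj
      (stupidFiltrationShortComplex K n₀ n₁ h).X₃)]
    [HasHyperExt.{w'} (F.obj X) (stupidFiltrationShortComplex
      ((F.mapHomologicalComplex (ComplexShape.up ℤ)).obj K) n₀ n₁ h).X₁]
    [HasHyperExt.{w'} (F.obj X) (stupidFiltrationShortComplex
      ((F.mapHomologicalComplex (ComplexShape.up ℤ)).obj K) n₀ n₁ h).X₃]
    [HasHyperExt.{w'} (F.obj X) (stupidFiltrationShortComplex K' n₀ n₁ h).X₁]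
    [HasHyperExt.{w'} (F.obj X) (stupidFiltrationShortComplex K' n₀ n₁ h).X₃]
    [HasHyperExt.{w'} X' (stupidFiltrationShortComplex K' n₀ n₁ h).X₁]
    [HasHyperExt.{w'} X' (stupidFiltrationShortComplex K' n₀ n₁ h).X₃]
    (x : HyperExt.{w} X (stupidFiltrationShortComplex K n₀ n₁ h).X₃ k₀) :
    restrictStupidFiltration₁ F e g n₀ n₁ h k₁
        (delta (shortExact_stupidFiltrationShortComplex K n₀ n₁ h) k₀ k₁ hk x) =
      delta (shortExact_stupidFiltrationShortComplex K' n₀ n₁ h) k₀ k₁ hk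
        (restrictStupidFiltration₃ F e g n₀ n₁ h k₀ x) := by
  haveI i₁ : HasHyperExt.{w'} (F.obj X) ((stupidFiltrationShortComplex K n₀ n₁ h).map
    (F.mapHomologicalComplex (ComplexShape.up ℤ))).X₁ := h₁
  haveI i₃ : HasHyperExt.{w'} (F.obj X) ((stupidFiltrationShortComplex K n₀ n₁ h).map
    (F.mapHomologicalComplex (ComplexShape.up ℤ))).X₃ := h₃
  have h1 := map_mapExactFunctor_stupidFiltration_delta F X K n₀ n₁ h k₀ k₁ hk x
  have h2 := delta_naturality
    (shortExact_stupidFiltrationShortComplex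
      ((F.mapHomologicalComplex (ComplexShape.up ℤ)).obj K) n₀ n₁ h)
    (shortExact_stupidFiltrationShortComplex K' n₀ n₁ h)
    (stupidFiltrationShortComplexMap g n₀ n₁ h) k₀ k₁ hk
    (map (mapStupidFiltrationShortComplexIso F K n₀ n₁ h).hom.τ₃ k₀ (mapExactFunctor F k₀ x))
  have h3 := delta_comap (shortExact_stupidFiltrationShortComplex K' n₀ n₁ h) e.inv k₀ k₁ hk
    (map (stupidFiltrationShortComplexMap g n₀ n₁ h).τ₃ k₀
      (map (mapStupidFiltrationShortComplexIso F K n₀ n₁ h).hom.τ₃ k₀ (mapExactFunctor F k₀ x)))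
  simp only [restrictStupidFiltration₁, restrictStupidFiltration₃, AddMonoidHom.coe_comp,
    Function.comp_apply, AddEquiv.toAddMonoidHom_eq_coe, AddMonoidHom.coe_coe,
    comapEquivOfIso_apply]
  exact ((congrArg
    (fun z => comap _ k₁ e.inv (map (stupidFiltrationShortComplexMap g n₀ n₁ h).τ₁ k₁ z))
    h1).trans (congrArg (comap _ k₁ e.inv) h2.symm)).trans h3.symm

/-- **Torsion transfer.** If the connecting map of `K'` is killed by nonzero integers (pointwise)
and the restriction on the `Kⁿ¹[-n₁]` terms has a kernel consisting of torsion classes, then the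
connecting map of `K` is killed by nonzero integers: `m • δ' (res x) = 0 ⇒ res (m • δ x) = 0 ⇒
m' m • δ x = 0`. [folklore] -/
theorem exists_smul_delta_eq_zero_of_restrict (k₀ k₁ : ℤ) (hk : k₀ + 1 = k₁)
    [HasHyperExt.{w} X (stupidFiltrationShortComplex K n₀ n₁ h).X₁]
    [HasHyperExt.{w} X (stupidFiltrationShortComplex K n₀ n₁ h).X₃]
    [h₁ : HasHyperExt.{w'} (F.obj X) ((F.mapHomologicalComplex (ComplexShape.up ℤ)).obj
      (stupidFiltrationShortComplex K n₀ n₁ h).X₁)]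
    [h₃ : HasHyperExt.{w'} (F.obj X) ((F.mapHomologicalComplex (ComplexShape.up ℤ)).obj
      (stupidFiltrationShortComplex K n₀ n₁ h).X₃)]
    [HasHyperExt.{w'} (F.obj X) (stupidFiltrationShortComplex
      ((F.mapHomologicalComplex (ComplexShape.up ℤ)).obj K) n₀ n₁ h).X₁]
    [HasHyperExt.{w'} (F.obj X) (stupidFiltrationShortComplex
      ((F.mapHomologicalComplex (ComplexShape.up ℤ)).obj K) n₀ n₁ h).X₃]
    [HasHyperExt.{w'} (F.obj X) (stupidFiltrationShortComplex K' n₀ n₁ h).X₁]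
    [HasHyperExt.{w'} (F.obj X) (stupidFiltrationShortComplex K' n₀ n₁ h).X₃]
    [HasHyperExt.{w'} X' (stupidFiltrationShortComplex K' n₀ n₁ h).X₁]
    [HasHyperExt.{w'} X' (stupidFiltrationShortComplex K' n₀ n₁ h).X₃]
    (hK' : ∀ x' : HyperExt.{w'} X' (stupidFiltrationShortComplex K' n₀ n₁ h).X₃ k₀,
      ∃ m : ℤ, m ≠ 0 ∧
        m • delta (shortExact_stupidFiltrationShortComplex K' n₀ n₁ h) k₀ k₁ hk x' = 0)
    (hker : ∀ y : HyperExt.{w} X (stupidFiltrationShortComplex K n₀ n₁ h).X₁ k₁,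
      restrictStupidFiltration₁ F e g n₀ n₁ h k₁ y = 0 → ∃ m : ℤ, m ≠ 0 ∧ m • y = 0)
    (x : HyperExt.{w} X (stupidFiltrationShortComplex K n₀ n₁ h).X₃ k₀) :
    ∃ m : ℤ, m ≠ 0 ∧
      m • delta (shortExact_stupidFiltrationShortComplex K n₀ n₁ h) k₀ k₁ hk x = 0 := by
  obtain ⟨m, hm, hmx⟩ := hK' (restrictStupidFiltration₃ F e g n₀ n₁ h k₀ x)
  rw [← restrictStupidFiltration_delta, ← map_zsmul] at hmx
  obtain ⟨m', hm', hm'x⟩ := hker _ hmx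
  exact ⟨m' * m, mul_ne_zero hm' hm, by rw [mul_smul, hm'x]⟩

end HyperExt

end Literature.Algebra.Homology
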